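import Summits.CriticalPhenomena.PercolationContinuityZ3.Theorems.Transplant.FKConnectivityAllQApexHubCyl
import Summits.CriticalPhenomena.PercolationContinuityZ3.Theorems.Transplant.FKConnectivityAllQThreePoint
import HarnessLib

/-!
# Connectivity correlation inequalities for `φ_{w,q}` — the HUB INEQUALITY WITH AN APEX TERMINAL AND A TERMINAL IN THE REST OF THE
# GRAPH: REDUCTION TO THE REST (algebra and bookkeeping), EVERY `q > 0`

Support file (`--supports stmt-CriticalPhenomena-4575`), census seat `prim-bschramm-census` (gen 23) of the post-continuity programme;
builds on p205010 (kernel theorem, internal audit signed; external expert review pending).  No definitions, no named facts, no sorries;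
standard axioms.  Continues the census seat gen 22's apex files (`…ApexHubCyl.lean`: leaf-type cylinders of an apex `x` over `(u, v)` and
the table lemma).

SETTING.  `x` is an APEX over `(u, v)` (every live pair at `x` is `ux` or `xv`), `t ∉ {x, u, v}` an ARBITRARY further vertex, the rest of the
weighted graph arbitrary.  Gen 22 treated the triples inside `{u, v} ∪ Apexes(u,v)`; here one terminal lies in the rest.  Peeling `x` by the
table lemma, every mass is a combination of the leaf-type weights of `x` and of the FIVE CELL MASSES of the rest — the masses, under
`w[ux, xv ↦ 0]`, of the five connectivity classes of `{u, v, t}`: `c0 = t|u|v`, `c1 = t|uv`, `c2 = tu|v`, `c3 = tv|u`, `c4 = tuv`.  This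
file: the cell bookkeeping (`cells_*`), the passage from `HubUnder` in the rest to a cell inequality (`mass_le_of_hubUnder`), and the three
pure-algebra certificates `apex_rest_o_alg` / `apex_rest_a_alg` / `apex_rest_b_alg`:
`Z·S(A ∩ B) − S(A)S(B) = κ·(rest hub slack) + N` with `κ, N` polynomials with nonnegative coefficients in `a, 1−a, b, 1−b, r` and the
cells (`a = w(ux)`, `b = w(xv)`, `r = q⁻¹`; so the reductions hold for EVERY `q > 0`) — found and checked by exact computer algebra (census seat gen 23, `code/apex/cert3.py`,
`gen_lean_rest2.py`; the three rest slacks are the hub inequalities of the rest at `(v;u;t)`, `(u;v;t)`, `(u;t;v)`).  File 2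
(`…ApexHubRest.lean`) assembles the three REDUCTION THEOREMS: the hub inequality at `(x;u;t)`, `(u;x;t)`, `(x;t;u)` in `G` follows from the
hub inequality at `(v;u;t)`, `(u;v;t)`, `(u;t;v)` respectively in `G` with the apex pairs deleted — "an apex terminal may be traded for the
opposite hub".
[cite: AyyerLinussonRavichandran2025, §7 eq. (13)–(15), Conj. 7.1 (p. 22)] [cite: Grimmett2006, Thm. (3.1)(a) (p. 37); §1.4 eq. (1.20) (p. 15); §3.9 (p. 63)]
-/

noncomputable section

namespace Summit.CriticalPhenomena.PercolationContinuityZ3.Theorems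

namespace FK

open MeasureTheory Set Literature.Probability.LatticeModels Literature.Probability.Percolation
open Literature.Probability.Percolation.DecisionTree (ind ind_of_mem ind_of_not_mem ind_nonneg)
open Literature.Probability.Percolation.TwoAvoidanceSets (ind_mul_ind)
open scoped Classical symmDiff

variable {V : Type*} [Fintype V]

/-! ### Cell bookkeeping: three events `K, T, T'` with `K ∩ T' ⊆ T`, `K ∩ T ⊆ T'`, `T ∩ T' ⊆ K` -/

section Cells

variable (w : Sym2 V → unitInterval) (q : ℝ) {K T T' : Set (BondConfig V)}

/-- `S(K) = c1 + c4`. [cite: Grimmett2006, §1.4 eq. (1.20) (p. 15)] -/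
theorem cells_K :
    ∑ ω : BondConfig V, rcWeightW w q ∅ ω * ind K ω =
      ∑ ω : BondConfig V, rcWeightW w q ∅ ω * ind (K ∩ Tᶜ) ω + ∑ ω : BondConfig V, rcWeightW w q ∅ ω * ind (K ∩ T) ω := by
  rw [sum_rcWeightW_ind_split w q K T]; ring

/-- `S(Kᶜ) = c0 + c2 + c3`. [cite: Grimmett2006, §1.4 eq. (1.20) (p. 15)] -/
theorem cells_Kc :
    ∑ ω : BondConfig V, rcWeightW w q ∅ ω * ind Kᶜ ω =
      ∑ ω : BondConfig V, rcWeightW w q ∅ ω * ind (Kᶜ ∩ (Tᶜ ∩ T'ᶜ)) ω + ∑ ω : BondConfig V, rcWeightW w q ∅ ω * ind (Kᶜ ∩ T) ω +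
        ∑ ω : BondConfig V, rcWeightW w q ∅ ω * ind (Kᶜ ∩ (Tᶜ ∩ T')) ω := by
  rw [sum_rcWeightW_ind_split w q Kᶜ T, sum_rcWeightW_ind_split w q (Kᶜ ∩ Tᶜ) T', Set.inter_assoc, Set.inter_assoc]; ring

/-- `Z° = c0 + c1 + c2 + c3 + c4`. [cite: Grimmett2006, §1.4 eq. (1.20) (p. 15)] -/
theorem cells_univ :
    ∑ ω : BondConfig V, rcWeightW w q ∅ ω * ind (Set.univ : Set (BondConfig V)) ω =
      ∑ ω : BondConfig V, rcWeightW w q ∅ ω * ind (Kᶜ ∩ (Tᶜ ∩ T'ᶜ)) ω + ∑ ω : BondConfig V, rcWeightW w q ∅ ω * ind (K ∩ Tᶜ) ω +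
        ∑ ω : BondConfig V, rcWeightW w q ∅ ω * ind (Kᶜ ∩ T) ω + ∑ ω : BondConfig V, rcWeightW w q ∅ ω * ind (Kᶜ ∩ (Tᶜ ∩ T')) ω +
          ∑ ω : BondConfig V, rcWeightW w q ∅ ω * ind (K ∩ T) ω := by
  rw [sum_rcWeightW_ind_univ_eq_add w q K, cells_K w q (T := T), cells_Kc w q (T := T) (T' := T')]; ring

/-- `S(T) = c2 + c4`. [cite: Grimmett2006, §1.4 eq. (1.20) (p. 15)] -/
theorem cells_T :
    ∑ ω : BondConfig V, rcWeightW w q ∅ ω * ind T ω =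
      ∑ ω : BondConfig V, rcWeightW w q ∅ ω * ind (Kᶜ ∩ T) ω + ∑ ω : BondConfig V, rcWeightW w q ∅ ω * ind (K ∩ T) ω := by
  rw [sum_rcWeightW_ind_split w q T K, Set.inter_comm T K, Set.inter_comm T Kᶜ]; ring

omit [Fintype V] in
/-- `T' ∩ K = K ∩ T`. [folklore] -/
theorem cells_set_T'K (h1 : K ∩ T' ⊆ T) (h2 : K ∩ T ⊆ T') : T' ∩ K = K ∩ T := by
  ext ω
  simp only [Set.mem_inter_iff]
  exact ⟨fun h => ⟨h.2, h1 ⟨h.2, h.1⟩⟩, fun h => ⟨h2 ⟨h.1, h.2⟩, h.1⟩⟩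

omit [Fintype V] in
/-- `T' ∩ Kᶜ = Kᶜ ∩ (Tᶜ ∩ T')`. [folklore] -/
theorem cells_set_T'Kc (h3 : T ∩ T' ⊆ K) : T' ∩ Kᶜ = Kᶜ ∩ (Tᶜ ∩ T') := by
  ext ω
  simp only [Set.mem_inter_iff, Set.mem_compl_iff]
  exact ⟨fun h => ⟨h.2, fun hT => h.2 (h3 ⟨hT, h.1⟩), h.1⟩, fun h => ⟨h.2.2, h.1⟩⟩

omit [Fintype V] in
/-- `T ∩ T' = K ∩ T`. [folklore] -/
theorem cells_set_TT' (h2 : K ∩ T ⊆ T') (h3 : T ∩ T' ⊆ K) : T ∩ T' = K ∩ T := by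
  ext ω
  simp only [Set.mem_inter_iff]
  exact ⟨fun h => ⟨h3 ⟨h.1, h.2⟩, h.1⟩, fun h => ⟨h.2, h2 ⟨h.1, h.2⟩⟩⟩

omit [Fintype V] in
/-- `(T ∪ T') ∩ K = K ∩ T`. [folklore] -/
theorem cells_set_UK (h1 : K ∩ T' ⊆ T) : (T ∪ T') ∩ K = K ∩ T := by
  ext ω
  simp only [Set.mem_inter_iff, Set.mem_union]
  exact ⟨fun h => ⟨h.2, h.1.elim id fun hT' => h1 ⟨h.2, hT'⟩⟩, fun h => ⟨Or.inl h.2, h.1⟩⟩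

omit [Fintype V] in
/-- `((T ∪ T') ∩ Kᶜ) ∩ T = Kᶜ ∩ T`. [folklore] -/
theorem cells_set_UKcT : (T ∪ T') ∩ Kᶜ ∩ T = Kᶜ ∩ T := by
  ext ω
  simp only [Set.mem_inter_iff, Set.mem_union, Set.mem_compl_iff]
  exact ⟨fun h => ⟨h.1.2, h.2⟩, fun h => ⟨⟨Or.inl h.2, h.1⟩, h.2⟩⟩

omit [Fintype V] in
/-- `((T ∪ T') ∩ Kᶜ) ∩ Tᶜ = Kᶜ ∩ (Tᶜ ∩ T')`. [folklore] -/
theorem cells_set_UKcTc : (T ∪ T') ∩ Kᶜ ∩ Tᶜ = Kᶜ ∩ (Tᶜ ∩ T') := by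
  ext ω
  simp only [Set.mem_inter_iff, Set.mem_union, Set.mem_compl_iff]
  exact ⟨fun h => ⟨h.1.2, h.2, h.1.1.elim (fun hT => absurd hT h.2) id⟩, fun h => ⟨⟨Or.inr h.2.2, h.1⟩, h.2.1⟩⟩

/-- `S(T') = c3 + c4`. [cite: Grimmett2006, §1.4 eq. (1.20) (p. 15)] -/
theorem cells_T' (h1 : K ∩ T' ⊆ T) (h2 : K ∩ T ⊆ T') (h3 : T ∩ T' ⊆ K) :
    ∑ ω : BondConfig V, rcWeightW w q ∅ ω * ind T' ω =
      ∑ ω : BondConfig V, rcWeightW w q ∅ ω * ind (Kᶜ ∩ (Tᶜ ∩ T')) ω + ∑ ω : BondConfig V, rcWeightW w q ∅ ω * ind (K ∩ T) ω := by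
  rw [sum_rcWeightW_ind_split w q T' K, cells_set_T'K h1 h2, cells_set_T'Kc h3]; ring

/-- `S(K ∩ T') = c4`. [cite: Grimmett2006, §1.4 eq. (1.20) (p. 15)] -/
theorem cells_KT' (h1 : K ∩ T' ⊆ T) (h2 : K ∩ T ⊆ T') :
    ∑ ω : BondConfig V, rcWeightW w q ∅ ω * ind (K ∩ T') ω = ∑ ω : BondConfig V, rcWeightW w q ∅ ω * ind (K ∩ T) ω := by
  rw [Set.inter_comm K T', cells_set_T'K h1 h2]

/-- `S(T ∩ T') = c4`. [cite: Grimmett2006, §1.4 eq. (1.20) (p. 15)] -/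
theorem cells_TT' (h2 : K ∩ T ⊆ T') (h3 : T ∩ T' ⊆ K) :
    ∑ ω : BondConfig V, rcWeightW w q ∅ ω * ind (T ∩ T') ω = ∑ ω : BondConfig V, rcWeightW w q ∅ ω * ind (K ∩ T) ω := by
  rw [cells_set_TT' h2 h3]

/-- `S(T ∪ T') = c2 + c3 + c4`. [cite: Grimmett2006, §1.4 eq. (1.20) (p. 15)] -/
theorem cells_U (h1 : K ∩ T' ⊆ T) :
    ∑ ω : BondConfig V, rcWeightW w q ∅ ω * ind (T ∪ T') ω =
      ∑ ω : BondConfig V, rcWeightW w q ∅ ω * ind (Kᶜ ∩ T) ω + ∑ ω : BondConfig V, rcWeightW w q ∅ ω * ind (Kᶜ ∩ (Tᶜ ∩ T')) ω +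
        ∑ ω : BondConfig V, rcWeightW w q ∅ ω * ind (K ∩ T) ω := by
  rw [sum_rcWeightW_ind_split w q (T ∪ T') K, cells_set_UK h1, sum_rcWeightW_ind_split w q ((T ∪ T') ∩ Kᶜ) T,
    cells_set_UKcT, cells_set_UKcTc]; ring

/-- `S((T ∪ T') ∩ Kᶜ) = c2 + c3`. [cite: Grimmett2006, §1.4 eq. (1.20) (p. 15)] -/
theorem cells_UKc :
    ∑ ω : BondConfig V, rcWeightW w q ∅ ω * ind ((T ∪ T') ∩ Kᶜ) ω =
      ∑ ω : BondConfig V, rcWeightW w q ∅ ω * ind (Kᶜ ∩ T) ω + ∑ ω : BondConfig V, rcWeightW w q ∅ ω * ind (Kᶜ ∩ (Tᶜ ∩ T')) ω := by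
  rw [sum_rcWeightW_ind_split w q ((T ∪ T') ∩ Kᶜ) T, cells_set_UKcT, cells_set_UKcTc]

end Cells

/-! ### From `HubUnder` in the rest to a mass inequality -/

/-- `μ(A)μ(B) ≤ μ(Ω)μ(A ∩ B)` for `μ = φ_{w,q}` gives `S(A)·S(B) ≤ Z·S(A ∩ B)` (converse of `real_mul_le_of_mass`).
[cite: Grimmett2006, §1.4 eq. (1.20) (p. 15)] -/
theorem mass_le_of_real_mul_le (w : Sym2 V → unitInterval) {q : ℝ} (hq : 0 < q) (A B : Set (BondConfig V))
    (h : (rcMeasureW w q ∅).real A * (rcMeasureW w q ∅).real B ≤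
      (rcMeasureW w q ∅).real univ * (rcMeasureW w q ∅).real (A ∩ B)) :
    (∑ ω : BondConfig V, rcWeightW w q ∅ ω * ind A ω) * (∑ ω : BondConfig V, rcWeightW w q ∅ ω * ind B ω) ≤
      rcPartitionFunctionW w q ∅ * ∑ ω : BondConfig V, rcWeightW w q ∅ ω * ind (A ∩ B) ω := by
  haveI := isProbabilityMeasure_rcMeasureW w hq (∅ : Set V)
  rw [probReal_univ, one_mul, rcMeasureW_real_eq_sum_div w hq ∅ A, rcMeasureW_real_eq_sum_div w hq ∅ B,
    rcMeasureW_real_eq_sum_div w hq ∅ (A ∩ B)] at h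
  have hZ := rcPartitionFunctionW_pos w hq (∅ : Set V)
  rw [div_mul_div_comm, div_le_div_iff₀ (mul_pos hZ hZ) hZ] at h
  have h' : (∑ ω : BondConfig V, rcWeightW w q ∅ ω * ind A ω) * (∑ ω : BondConfig V, rcWeightW w q ∅ ω * ind B ω) *
      rcPartitionFunctionW w q ∅ ≤
      (rcPartitionFunctionW w q ∅ * ∑ ω : BondConfig V, rcWeightW w q ∅ ω * ind (A ∩ B) ω) * rcPartitionFunctionW w q ∅ := by
    calc _ ≤ (∑ ω : BondConfig V, rcWeightW w q ∅ ω * ind (A ∩ B) ω) * (rcPartitionFunctionW w q ∅ * rcPartitionFunctionW w q ∅) := h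
      _ = _ := by ring
  exact le_of_mul_le_mul_right h' hZ

/-! ### The three certificates (pure algebra) -/

/-- Pure algebra for `hubUnder_apex_rest_o` (`(x; u; t)`): `Z·S(A∩B) − S(A)S(B) = κ·(Z°S°(v↔u↔t) − S°(v↔u)S°(t↔u)) + N` with `κ, N ≥ 0`.
The cells are the five connectivity classes of `{u,v,t}` in the rest: `c0 = t|u|v`, `c1 = t|uv`, `c2 = tu|v`, `c3 = tv|u`, `c4 = tuv`.
[cite: AyyerLinussonRavichandran2025, §7 eq. (13) (p. 22)] -/
theorem apex_rest_o_alg {a b r c0 c1 c2 c3 c4 SA SB SAB Z : ℝ} (ha0 : 0 ≤ a) (ha1 : 0 ≤ 1 - a) (hb0 : 0 ≤ b) (hb1 : 0 ≤ 1 - b)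
    (hr : 0 ≤ r) (h0 : 0 ≤ c0) (h1 : 0 ≤ c1) (h2 : 0 ≤ c2) (h3 : 0 ≤ c3) (h4 : 0 ≤ c4)
    (hrest : 0 ≤ (c0 + c1 + c2 + c3 + c4) * c4 - (c1 + c4) * (c2 + c4))
    (hSA : SA = a * b * r * ((c0 + c1 + c2 + c3 + c4) + (r - 1) * (c0 + c2 + c3)) + a * (1 - b) * r * (c0 + c1 + c2 + c3 + c4) + (1 - a) * b * r * (c1 +
      c4) + (1 - a) * (1 - b) * 0)
    (hSB : SB = a * b * r * ((c2 + c3 + c4) + (r - 1) * (c2 + c3)) + a * (1 - b) * r * (c2 + c4) + (1 - a) * b * r * (c2 + c4) + (1 - a) * (1 - b) * (c2 + c4))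
    (hSAB : SAB = a * b * r * ((c2 + c3 + c4) + (r - 1) * (c2 + c3)) + a * (1 - b) * r * (c2 + c4) + (1 - a) * b * r * c4 + (1 - a) * (1 - b) * 0)
    (hZ : Z = a * b * r * ((c0 + c1 + c2 + c3 + c4) + (r - 1) * (c0 + c2 + c3)) + a * (1 - b) * r * (c0 + c1 + c2 + c3 + c4) + (1 - a) * b * r * (c0 +
      c1 + c2 + c3 + c4) + (1 - a) * (1 - b) * (c0 + c1 + c2 + c3 + c4)) :
    SA * SB ≤ Z * SAB := by
  rw [← sub_nonneg]
  have key : Z * SAB - SA * SB =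
      ((1 - a) * (1 - a) * b * (1 - b) * r + (1 - a) * (1 - a) * b * b * r * r + a * (1 - a) * b * (1 - b) * r + a * (1 - a) * b * b * r * r) *
        ((c0 + c1 + c2 + c3 + c4) * c4 - (c1 + c4) * (c2 + c4)) +
      ((a * (1 - a) * b * (1 - b) * r * r + a * (1 - a) * b * b * r * r * r) * (c0 * c3) + (a * (1 - a) * b * (1 - b) * r * r) * (c1 * c3) +
        (a * (1 - a) * b * (1 - b) * r * r + a * (1 - a) * b * b * r * r * r) * (c2 * c3) + (a * (1 - a) * b * (1 - b) * r * r) * (c4 * c3) +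
        (a * (1 - a) * b * (1 - b) * r * r + a * (1 - a) * b * b * r * r * r) * (c3 * c3)) := by
    rw [hSA, hSB, hSAB, hZ]; ring
  rw [key]
  have hk : 0 ≤ ((1 - a) * (1 - a) * b * (1 - b) * r + (1 - a) * (1 - a) * b * b * r * r + a * (1 - a) * b * (1 - b) * r +
    a * (1 - a) * b * b * r * r) := by positivity
  have hN : 0 ≤ (a * (1 - a) * b * (1 - b) * r * r + a * (1 - a) * b * b * r * r * r) * (c0 * c3) + (a * (1 - a) * b * (1 - b) * r * r) * (c1 * c3) +
    (a * (1 - a) * b * (1 - b) * r * r + a * (1 - a) * b * b * r * r * r) * (c2 * c3) + (a * (1 - a) * b * (1 - b) * r * r) * (c4 * c3) +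
    (a * (1 - a) * b * (1 - b) * r * r + a * (1 - a) * b * b * r * r * r) * (c3 * c3) := by positivity
  exact add_nonneg (mul_nonneg hk hrest) hN

/-- Pure algebra for `hubUnder_apex_rest_a` (`(u; x; t)`): `Z·S(A∩B) − S(A)S(B) = κ·(Z°S°(u↔v↔t) − S°(u↔v)S°(t↔v)) + N` with `κ, N ≥ 0`.
The cells are the five connectivity classes of `{u,v,t}` in the rest: `c0 = t|u|v`, `c1 = t|uv`, `c2 = tu|v`, `c3 = tv|u`, `c4 = tuv`.
[cite: AyyerLinussonRavichandran2025, §7 eq. (13) (p. 22)] -/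
theorem apex_rest_a_alg {a b r c0 c1 c2 c3 c4 SA SB SAB Z : ℝ} (ha0 : 0 ≤ a) (ha1 : 0 ≤ 1 - a) (hb0 : 0 ≤ b) (hb1 : 0 ≤ 1 - b)
    (hr : 0 ≤ r) (h0 : 0 ≤ c0) (h1 : 0 ≤ c1) (h2 : 0 ≤ c2) (h3 : 0 ≤ c3) (h4 : 0 ≤ c4)
    (hrest : 0 ≤ (c0 + c1 + c2 + c3 + c4) * c4 - (c1 + c4) * (c3 + c4))
    (hSA : SA = a * b * r * ((c0 + c1 + c2 + c3 + c4) + (r - 1) * (c0 + c2 + c3)) + a * (1 - b) * r * (c0 + c1 + c2 + c3 + c4) + (1 - a) * b * r * (c1 +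
      c4) + (1 - a) * (1 - b) * 0)
    (hSB : SB = a * b * r * ((c2 + c3 + c4) + (r - 1) * (c2 + c3)) + a * (1 - b) * r * (c2 + c4) + (1 - a) * b * r * (c3 + c4) + (1 - a) * (1 - b) * 0)
    (hSAB : SAB = a * b * r * ((c2 + c3 + c4) + (r - 1) * (c2 + c3)) + a * (1 - b) * r * (c2 + c4) + (1 - a) * b * r * c4 + (1 - a) * (1 - b) * 0)
    (hZ : Z = a * b * r * ((c0 + c1 + c2 + c3 + c4) + (r - 1) * (c0 + c2 + c3)) + a * (1 - b) * r * (c0 + c1 + c2 + c3 + c4) + (1 - a) * b * r * (c0 +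
      c1 + c2 + c3 + c4) + (1 - a) * (1 - b) * (c0 + c1 + c2 + c3 + c4)) :
    SA * SB ≤ Z * SAB := by
  rw [← sub_nonneg]
  have key : Z * SAB - SA * SB =
      ((1 - a) * (1 - a) * b * b * r * r + a * (1 - a) * b * b * r * r) *
        ((c0 + c1 + c2 + c3 + c4) * c4 - (c1 + c4) * (c3 + c4)) +
      ((a * (1 - a) * (1 - b) * (1 - b) * r + 2 * a * (1 - a) * b * (1 - b) * r * r + a * (1 - a) * b * b * r * r * r) * (c0 * c2) +
        ((1 - a) * (1 - a) * b * (1 - b) * r + a * (1 - a) * (1 - b) * (1 - b) * r + a * (1 - a) * b * (1 - b) * r +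
        a * (1 - a) * b * (1 - b) * r * r) * (c0 * c4) + (a * (1 - a) * (1 - b) * (1 - b) * r + a * (1 - a) * b * (1 - b) * r * r) * (c1 * c2) +
        ((1 - a) * (1 - a) * b * (1 - b) * r + a * (1 - a) * (1 - b) * (1 - b) * r + a * (1 - a) * b * (1 - b) * r) * (c1 * c4) +
        (a * (1 - a) * (1 - b) * (1 - b) * r + 2 * a * (1 - a) * b * (1 - b) * r * r + a * (1 - a) * b * b * r * r * r) * (c2 * c2) +
        ((1 - a) * (1 - a) * b * (1 - b) * r + 2 * a * (1 - a) * (1 - b) * (1 - b) * r + a * (1 - a) * b * (1 - b) * r +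
        2 * a * (1 - a) * b * (1 - b) * r * r) * (c2 * c4) + (a * (1 - a) * (1 - b) * (1 - b) * r + 2 * a * (1 - a) * b * (1 - b) * r * r +
        a * (1 - a) * b * b * r * r * r) * (c2 * c3) + ((1 - a) * (1 - a) * b * (1 - b) * r + a * (1 - a) * (1 - b) * (1 - b) * r +
        a * (1 - a) * b * (1 - b) * r) * (c4 * c4) + ((1 - a) * (1 - a) * b * (1 - b) * r + a * (1 - a) * (1 - b) * (1 - b) * r +
        a * (1 - a) * b * (1 - b) * r + a * (1 - a) * b * (1 - b) * r * r) * (c4 * c3)) := by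
    rw [hSA, hSB, hSAB, hZ]; ring
  rw [key]
  have hk : 0 ≤ ((1 - a) * (1 - a) * b * b * r * r + a * (1 - a) * b * b * r * r) := by positivity
  have hN : 0 ≤ (a * (1 - a) * (1 - b) * (1 - b) * r + 2 * a * (1 - a) * b * (1 - b) * r * r + a * (1 - a) * b * b * r * r * r) * (c0 * c2) +
    ((1 - a) * (1 - a) * b * (1 - b) * r + a * (1 - a) * (1 - b) * (1 - b) * r + a * (1 - a) * b * (1 - b) * r +
    a * (1 - a) * b * (1 - b) * r * r) * (c0 * c4) + (a * (1 - a) * (1 - b) * (1 - b) * r + a * (1 - a) * b * (1 - b) * r * r) * (c1 * c2) +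
    ((1 - a) * (1 - a) * b * (1 - b) * r + a * (1 - a) * (1 - b) * (1 - b) * r + a * (1 - a) * b * (1 - b) * r) * (c1 * c4) +
    (a * (1 - a) * (1 - b) * (1 - b) * r + 2 * a * (1 - a) * b * (1 - b) * r * r + a * (1 - a) * b * b * r * r * r) * (c2 * c2) +
    ((1 - a) * (1 - a) * b * (1 - b) * r + 2 * a * (1 - a) * (1 - b) * (1 - b) * r + a * (1 - a) * b * (1 - b) * r +
    2 * a * (1 - a) * b * (1 - b) * r * r) * (c2 * c4) + (a * (1 - a) * (1 - b) * (1 - b) * r + 2 * a * (1 - a) * b * (1 - b) * r * r +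
    a * (1 - a) * b * b * r * r * r) * (c2 * c3) + ((1 - a) * (1 - a) * b * (1 - b) * r + a * (1 - a) * (1 - b) * (1 - b) * r +
    a * (1 - a) * b * (1 - b) * r) * (c4 * c4) + ((1 - a) * (1 - a) * b * (1 - b) * r + a * (1 - a) * (1 - b) * (1 - b) * r +
    a * (1 - a) * b * (1 - b) * r + a * (1 - a) * b * (1 - b) * r * r) * (c4 * c3) := by positivity
  exact add_nonneg (mul_nonneg hk hrest) hN

/-- Pure algebra for `hubUnder_apex_rest_b` (`(x; t; u)`): `Z·S(A∩B) − S(A)S(B) = κ·(Z°S°(u↔t↔v) − S°(u↔t)S°(v↔t)) + N` with `κ, N ≥ 0`.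
The cells are the five connectivity classes of `{u,v,t}` in the rest: `c0 = t|u|v`, `c1 = t|uv`, `c2 = tu|v`, `c3 = tv|u`, `c4 = tuv`.
[cite: AyyerLinussonRavichandran2025, §7 eq. (13) (p. 22)] -/
theorem apex_rest_b_alg {a b r c0 c1 c2 c3 c4 SA SB SAB Z : ℝ} (ha0 : 0 ≤ a) (ha1 : 0 ≤ 1 - a) (hb0 : 0 ≤ b) (hb1 : 0 ≤ 1 - b)
    (hr : 0 ≤ r) (h0 : 0 ≤ c0) (h1 : 0 ≤ c1) (h2 : 0 ≤ c2) (h3 : 0 ≤ c3) (h4 : 0 ≤ c4)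
    (hrest : 0 ≤ (c0 + c1 + c2 + c3 + c4) * c4 - (c2 + c4) * (c3 + c4))
    (hSA : SA = a * b * r * ((c2 + c3 + c4) + (r - 1) * (c2 + c3)) + a * (1 - b) * r * (c2 + c4) + (1 - a) * b * r * (c3 + c4) + (1 - a) * (1 - b) * 0)
    (hSB : SB = a * b * r * ((c2 + c3 + c4) + (r - 1) * (c2 + c3)) + a * (1 - b) * r * (c2 + c4) + (1 - a) * b * r * (c2 + c4) + (1 - a) * (1 - b) * (c2 + c4))
    (hSAB : SAB = a * b * r * ((c2 + c3 + c4) + (r - 1) * (c2 + c3)) + a * (1 - b) * r * (c2 + c4) + (1 - a) * b * r * c4 + (1 - a) * (1 - b) * 0)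
    (hZ : Z = a * b * r * ((c0 + c1 + c2 + c3 + c4) + (r - 1) * (c0 + c2 + c3)) + a * (1 - b) * r * (c0 + c1 + c2 + c3 + c4) + (1 - a) * b * r * (c0 +
      c1 + c2 + c3 + c4) + (1 - a) * (1 - b) * (c0 + c1 + c2 + c3 + c4)) :
    SA * SB ≤ Z * SAB := by
  rw [← sub_nonneg]
  have key : Z * SAB - SA * SB =
      ((1 - a) * (1 - a) * b * (1 - b) * r + (1 - a) * (1 - a) * b * b * r * r) *
        ((c0 + c1 + c2 + c3 + c4) * c4 - (c2 + c4) * (c3 + c4)) +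
      ((a * (1 - a) * (1 - b) * (1 - b) * r + 2 * a * (1 - a) * b * (1 - b) * r * r + a * (1 - a) * b * b * r * r * r +
        a * a * (1 - b) * (1 - b) * r * r + 2 * a * a * b * (1 - b) * r * r * r + a * a * b * b * r * r * r * r) * (c0 * c2) +
        (a * (1 - a) * (1 - b) * (1 - b) * r + a * (1 - a) * b * (1 - b) * r + 2 * a * (1 - a) * b * (1 - b) * r * r + a * (1 - a) * b * b * r * r +
        a * (1 - a) * b * b * r * r * r + a * a * (1 - b) * (1 - b) * r * r + a * a * b * (1 - b) * r * r + a * a * b * (1 - b) * r * r * r +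
        a * a * b * b * r * r * r) * (c0 * c4) + (a * (1 - a) * b * (1 - b) * r * r + a * (1 - a) * b * b * r * r * r +
        a * a * b * (1 - b) * r * r * r + a * a * b * b * r * r * r * r) * (c0 * c3) + (a * (1 - a) * (1 - b) * (1 - b) * r +
        2 * a * (1 - a) * b * (1 - b) * r * r + a * (1 - a) * b * b * r * r * r + a * a * (1 - b) * (1 - b) * r * r + a * a * b * (1 - b) * r * r +
        a * a * b * (1 - b) * r * r * r + a * a * b * b * r * r * r) * (c1 * c2) + (a * (1 - a) * (1 - b) * (1 - b) * r +
        a * (1 - a) * b * (1 - b) * r + 2 * a * (1 - a) * b * (1 - b) * r * r + 2 * a * (1 - a) * b * b * r * r + a * a * (1 - b) * (1 - b) * r * r +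
        2 * a * a * b * (1 - b) * r * r + a * a * b * b * r * r) * (c1 * c4) + (a * (1 - a) * b * (1 - b) * r * r + a * (1 - a) * b * b * r * r * r +
        a * a * b * (1 - b) * r * r * r + a * a * b * b * r * r * r) * (c1 * c3) + (a * (1 - a) * (1 - b) * (1 - b) * r +
        a * (1 - a) * b * (1 - b) * r * r + a * a * (1 - b) * (1 - b) * r * r + a * a * b * (1 - b) * r * r * r) * (c2 * c3) +
        (a * (1 - a) * (1 - b) * (1 - b) * r + a * (1 - a) * b * (1 - b) * r + a * (1 - a) * b * (1 - b) * r * r + a * a * (1 - b) * (1 - b) * r * r +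
        a * a * b * (1 - b) * r * r) * (c4 * c3) + (a * (1 - a) * b * (1 - b) * r * r + a * a * b * (1 - b) * r * r * r) * (c3 * c3)) := by
    rw [hSA, hSB, hSAB, hZ]; ring
  rw [key]
  have hk : 0 ≤ ((1 - a) * (1 - a) * b * (1 - b) * r + (1 - a) * (1 - a) * b * b * r * r) := by positivity
  have hN : 0 ≤ (a * (1 - a) * (1 - b) * (1 - b) * r + 2 * a * (1 - a) * b * (1 - b) * r * r + a * (1 - a) * b * b * r * r * r +
    a * a * (1 - b) * (1 - b) * r * r + 2 * a * a * b * (1 - b) * r * r * r + a * a * b * b * r * r * r * r) * (c0 * c2) +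
    (a * (1 - a) * (1 - b) * (1 - b) * r + a * (1 - a) * b * (1 - b) * r + 2 * a * (1 - a) * b * (1 - b) * r * r + a * (1 - a) * b * b * r * r +
    a * (1 - a) * b * b * r * r * r + a * a * (1 - b) * (1 - b) * r * r + a * a * b * (1 - b) * r * r + a * a * b * (1 - b) * r * r * r +
    a * a * b * b * r * r * r) * (c0 * c4) + (a * (1 - a) * b * (1 - b) * r * r + a * (1 - a) * b * b * r * r * r + a * a * b * (1 - b) * r * r * r +
    a * a * b * b * r * r * r * r) * (c0 * c3) + (a * (1 - a) * (1 - b) * (1 - b) * r + 2 * a * (1 - a) * b * (1 - b) * r * r +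
    a * (1 - a) * b * b * r * r * r + a * a * (1 - b) * (1 - b) * r * r + a * a * b * (1 - b) * r * r + a * a * b * (1 - b) * r * r * r +
    a * a * b * b * r * r * r) * (c1 * c2) + (a * (1 - a) * (1 - b) * (1 - b) * r + a * (1 - a) * b * (1 - b) * r +
    2 * a * (1 - a) * b * (1 - b) * r * r + 2 * a * (1 - a) * b * b * r * r + a * a * (1 - b) * (1 - b) * r * r + 2 * a * a * b * (1 - b) * r * r +
    a * a * b * b * r * r) * (c1 * c4) + (a * (1 - a) * b * (1 - b) * r * r + a * (1 - a) * b * b * r * r * r + a * a * b * (1 - b) * r * r * r +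
    a * a * b * b * r * r * r) * (c1 * c3) + (a * (1 - a) * (1 - b) * (1 - b) * r + a * (1 - a) * b * (1 - b) * r * r +
    a * a * (1 - b) * (1 - b) * r * r + a * a * b * (1 - b) * r * r * r) * (c2 * c3) + (a * (1 - a) * (1 - b) * (1 - b) * r +
    a * (1 - a) * b * (1 - b) * r + a * (1 - a) * b * (1 - b) * r * r + a * a * (1 - b) * (1 - b) * r * r + a * a * b * (1 - b) * r * r) * (c4 * c3) +
    (a * (1 - a) * b * (1 - b) * r * r + a * a * b * (1 - b) * r * r * r) * (c3 * c3) := by positivity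
  exact add_nonneg (mul_nonneg hk hrest) hN


end FK

end Summit.CriticalPhenomena.PercolationContinuityZ3.Theorems

end
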